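import Summits.HodgeConjecture.HodgeConjecture.Theorems.H413ThetaDistHolCotForms
import Literature.RepresentationTheory.TwistedCoinvariants
import HarnessLib

/-!
# FLOOR-0 P4, seat S4′(i), junction (J-g) model side, DESCENT — the model's theta distribution DESCENDS to the `χ`-coinvariants of its own
# finite Weil representation, as a `rightRep`-equivariant map into `holCotForms (archFactorOf F V)`

Cell hodgecm-mathlib (D-0151), FLOOR 0, crux item H413 = stmt-HodgeConjecture-24833; programme P4, line
`Cruxes/H413/Lines/F0_P4AdmissibleOccursInH1.lean`, stub S4′ `stub_T3a_holThetaRealisationOfRallisAt`.  Author F0P4-p01 (g0) (seat (i));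
SEAT-i MEMO v2 §5 (J-g).  `--supports stmt-HodgeConjecture-24833 --as helper`.  DEF-FREE (an `∃ θ` statement; theorems only).

THE MODEL HALF OF `HolReal t` IN THE SHAPE OF THE STUB.  For a side `S` with `S.ιinf = archInfOf V`, `(S.P k).ΓU = Γ`, `sat(K) ≤ S.Gfin` for all `K`,
a product datum `D : S.ThetaDistDatum hV k` with the analytic inputs `hLF hd hCR` of ★ `isHolGerm_dist`, and a character `χ` of the torus quotient
`[E¹] = relNormOneIdeles ⧸ relNormOneRat`:

* §1 `commute_ωf_inl_inr` — the two members of `D.ωf` commute (so the `U(V)(𝔸_f)`-member acts on the `χ`-coinvariants of the `U(W)(𝔸_f)`-member,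
  ★ `TwistedCoinv.rep`);
* §2 **`exists_coinvLift_dist`** — there is a `ℂ`-linear
  `θ : TwistedCoinv.Coinv (D.ωf ∘ inr) (D.chiFin χ) →ₗ[ℂ] ((adelicDatum F V).Adelic → ℂ²)` with
  (i) `θ (mk Φ_f) = (D.dist (charInv χ) Φ_f) ∘ latticeEquiv` (★ `TwistedCoinv.lift` of the `χ`-covariant transported distribution, ★
  `funLeft_latticeEquiv_dist_ωf_W`), (ii) `θ (rep g x) = rightRep F V g (θ x)` — EQUIVARIANCE ON THE NOSE (★ `TwistedCoinv.lift_rep`, ★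
  `funLeft_latticeEquiv_dist_ωf_V`), (iii) `θ x ∈ holCotForms (archFactorOf F V)` for every `x` (★ `funLeft_latticeEquiv_dist_mem_holCotForms` at the open
  level `D.smooth` supplies), (iv) `θ = 0 ↔ ∀ Φ_f, D.dist (charInv χ) Φ_f = 0` (★ `TwistedCoinv.lift_eq_zero_iff`, injectivity of the transport);
* §3 the same at ★ `ThetaDistAtLine.sideAt` (`exists_coinvLift_distDatumAt`-shape: the two `rfl`s and `sat(K) ≤ archFinOf V` discharged).

So S4′'s `θ_t` = this `θ` precomposed with an equivariant identification `ω_V(t) ≃ Coinv (D.ωf ∘ inr) (D.chiFin χ̃)` (junction J-a ★ ∕ J-b ★ p792671 ∕ J-c `rfl` ∕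
J-d knob + LT, A-p17) and `θ_t ≠ 0` = «`D.dist (charInv χ̃) ≠ 0`» (seat (ii)).  HC_CM is proved only modulo the printed citations until rung 0 closes.

## References
* [Liu2021] Y. Liu, Camb. J. Math. 9 (2021) = arXiv:2102.11518, proof of Prop. 4.13 (l. 2145), App. D §D.1 Step 3 (l. 5219–5221).
* [Weil1964] A. Weil, Acta Math. 111 (1964), Chap. III n° 41.  [BorelJacquet1979] A. Borel, H. Jacquet, Corvallis PSPM 33.1, §4.2.
* Tree: ★ `Literature/RepresentationTheory/TwistedCoinvariants` (`Coinv`, `mk`, `lift`, `rep`, `lift_rep`, `lift_eq_zero_iff`), ★ `Theorems/H413ThetaDistHolCotForms`,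
  ★ `HodgeCM/Model/AdelicThetaDistribution` (`ThetaDistDatum`, `chiFin`, `smooth`).
-/

set_option autoImplicit false
set_option linter.dupNamespace false

noncomputable section

open MulAction NumberField NumberField.mixedEmbedding IsDedekindDomain
open scoped SchwartzMap TensorProduct Classical
open Literature.NumberTheory.Automorphic Literature.NumberTheory.Automorphic.UnitaryGroup Literature.NumberTheory.Weil1964
open Literature.Geometry.ComplexHyperbolic.BallModel (U21 x₀)
open Literature.AlgebraicGeometry.ShimuraVarieties
open Literature.AlgebraicGeometry.Motives (CMType)
open Literature.NumberTheory.GelbartRogawski1991 Literature.NumberTheory.GelbartRogawski1991.UnitaryDualPair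
open HodgeCM HodgeCM.Adelic HodgeCM.PerL34 HodgeCM.Model HodgeCM.Model.ThetaSpace HodgeCM.Model.ArchSideTerm HodgeCM.Model.ThetaAdelicSide
open HodgeCM.Model.SupplyResidual.WeilPairData (charInv)
open Summit.HodgeConjecture.HodgeConjecture.Cruxes.H413.CohFormsCarriers
open Summit.HodgeConjecture.HodgeConjecture.Cruxes.H413.CuspCot

namespace Summit.HodgeConjecture.HodgeConjecture.Cruxes.H413.ThetaJunction

variable (F : HodgeCM.CMField) {ι₁ : F →+* ℂ} (V : HodgeCM.HermSpace3 F ι₁) (hV : IsAnisotropic F (HodgeCM.HermSpace3.Hm V))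

section Generic

variable {c : SeesawCtx F} {S : ThetaAdelicSide V c} {k : Fin 4} (D : S.ThetaDistDatum hV k)

/-! ## §1 The two members of the finite Weil representation of the datum commute -/

/-- `D.ωf (g, 1)` and `D.ωf (1, u)` commute (both are `D.ωf (g, u)`). [folklore] -/
theorem commute_ωf_inl_inr (g : ↥(HodgeCM.HermSpace3.adelicFin V)) (u : D.Uf) :
    Commute (D.ωf.comp (MonoidHom.inl _ _) g) (D.ωf.comp (MonoidHom.inr _ _) u) := by
  show Commute (D.ωf (g, 1)) (D.ωf (1, u))
  rw [Commute, SemiconjBy, ← map_mul, ← map_mul, Prod.mk_mul_mk, Prod.mk_mul_mk, one_mul, mul_one, one_mul, mul_one]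

/-! ## §2 The descent -/

variable (hι : S.ιinf = archInfOf V) (hΓ : (S.P k).ΓU = (V.latticeModel printFact_unitaryCompact_holds).Γ)
  (hGfin : ∀ K : Subgroup ↥(HodgeCM.HermSpace3.adelicFin V), ThetaDistDatum.satG hV K ≤ S.Gfin)
  (hLF : (S.P k).IsLFAction)
  (hd : ∀ (T : 𝓢((Fin 3 → mixedSpace (↥(maximalRealSubfield F))), ℂ) →L[ℂ] ℂ) (ℓ : Module.Dual ℂ (Fin 2 → ℂ)),
    DifferentiableAt ℝ (fun b => T (D.ωA (BallForms.expP b) (D.Φarch ℓ))) 0)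
  (hCR : ∀ (T : 𝓢((Fin 3 → mixedSpace (↥(maximalRealSubfield F))), ℂ) →L[ℂ] ℂ) (ℓ : Module.Dual ℂ (Fin 2 → ℂ)) (v : Fin 2 → ℂ),
    fderiv ℝ (fun b => T (D.ωA (BallForms.expP b) (D.Φarch ℓ))) 0 (Complex.I • v) =
      Complex.I • fderiv ℝ (fun b => T (D.ωA (BallForms.expP b) (D.Φarch ℓ))) 0 v)
  (χ : PontryaginDual (↥(Literature.NumberTheory.Automorphic.relNormOneIdeles (↥(maximalRealSubfield F)) F) ⧸
      Literature.NumberTheory.Automorphic.relNormOneRat (↥(maximalRealSubfield F)) F))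

include hι hΓ hGfin hLF hd hCR in
/-- **THE MODEL HALF OF `HolReal`, IN THE STUB'S SHAPE.**  The transported theta distribution `Φ_f ↦ (D.dist (charInv χ) Φ_f) ∘ latticeEquiv` descends to a
`ℂ`-linear map on the `χ`-coinvariants of the `U(W)(𝔸_f)`-member of `D.ωf` which is `rightRep`-EQUIVARIANT ON THE NOSE for the `U(V)(𝔸_f)`-member, takes values
in `holCotForms (archFactorOf F V)`, and vanishes iff the `χ`-component of the distribution does.
[cite: Liu2021, proof of Prop. 4.13, l. 2145; App. D §D.1 Step 3 (l. 5219–5221)] [cite: Weil1964, Chap. III n° 41] -/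
theorem exists_coinvLift_dist :
    ∃ θ : Literature.RepresentationTheory.TwistedCoinv.Coinv (D.ωf.comp (MonoidHom.inr _ _)) (D.chiFin χ) →ₗ[ℂ] ((adelicDatum F V).Adelic → (Fin 2 → ℂ)),
      (∀ Φf : FinSB (↥(maximalRealSubfield F)) (Fin 3),
          θ (Literature.RepresentationTheory.TwistedCoinv.mk (D.ωf.comp (MonoidHom.inr _ _)) (D.chiFin χ) Φf) =
            LinearMap.funLeft ℂ (Fin 2 → ℂ) (latticeEquiv F V hV) (D.dist (charInv χ) Φf)) ∧
        (∀ (g : ↥(HodgeCM.HermSpace3.adelicFin V)) (x : Literature.RepresentationTheory.TwistedCoinv.Coinv (D.ωf.comp (MonoidHom.inr _ _)) (D.chiFin χ)),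
            θ (Literature.RepresentationTheory.TwistedCoinv.rep (D.chiFin χ) (D.ωf.comp (MonoidHom.inl _ _)) (commute_ωf_inl_inr F V hV D) g x) =
              rightRep F V g (θ x)) ∧
          (∀ x, θ x ∈ holCotForms (archFactorOf F V)) ∧
            (θ = 0 ↔ ∀ Φf : FinSB (↥(maximalRealSubfield F)) (Fin 3), D.dist (charInv χ) Φf = 0) := by
  -- the `χ`-covariant linear map to be descended: the transported distribution
  let f₀ : FinSB (↥(maximalRealSubfield F)) (Fin 3) →ₗ[ℂ] ((adelicDatum F V).Adelic → (Fin 2 → ℂ)) :=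
    LinearMap.funLeft ℂ (Fin 2 → ℂ) (latticeEquiv F V hV) ∘ₗ D.dist (charInv χ)
  have hf₀ : ∀ (u : D.Uf) (Φf : FinSB (↥(maximalRealSubfield F)) (Fin 3)),
      f₀ (D.ωf.comp (MonoidHom.inr _ _) u Φf) = ((D.chiFin χ u : ℂˣ) : ℂ) • f₀ Φf := fun u Φf =>
    funLeft_latticeEquiv_dist_ωf_W F V hV D χ u Φf
  have hσ : ∀ (g : ↥(HodgeCM.HermSpace3.adelicFin V)) (Φf : FinSB (↥(maximalRealSubfield F)) (Fin 3)),
      f₀ (D.ωf.comp (MonoidHom.inl _ _) g Φf) = rightRep F V g (f₀ Φf) := fun g Φf =>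
    funLeft_latticeEquiv_dist_ωf_V F V hV D (charInv χ) g Φf
  refine ⟨Literature.RepresentationTheory.TwistedCoinv.lift (D.ωf.comp (MonoidHom.inr _ _)) (D.chiFin χ) f₀ hf₀, fun Φf => ?_, fun g x => ?_, fun x => ?_, ?_⟩
  · -- (i) on generators
    rw [Literature.RepresentationTheory.TwistedCoinv.lift_mk]
    rfl
  · -- (ii) equivariance on the nose
    exact Literature.RepresentationTheory.TwistedCoinv.lift_rep (D.chiFin χ) (D.ωf.comp (MonoidHom.inl _ _)) (commute_ωf_inl_inr F V hV D) f₀ hf₀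
      (rightRep F V) hσ g x
  · -- (iii) values in `holCotForms 𝔞₀`, at the open level fixing the generator
    obtain ⟨Φf, rfl⟩ := Literature.RepresentationTheory.TwistedCoinv.mk_surjective (D.ωf.comp (MonoidHom.inr _ _)) (D.chiFin χ) x
    rw [Literature.RepresentationTheory.TwistedCoinv.lift_mk]
    obtain ⟨K₀, hK₀o, hfix⟩ := D.smooth Φf
    exact funLeft_latticeEquiv_dist_mem_holCotForms F V hV D hι hΓ (hGfin K₀) hLF hd hCR (charInv χ) hfix hK₀o
  · -- (iv) non-vanishing is that of the `χ`-component of the distribution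
    rw [Literature.RepresentationTheory.TwistedCoinv.lift_eq_zero_iff]
    constructor
    · intro h Φf
      have h1 : f₀ Φf = 0 := by rw [h, LinearMap.zero_apply]
      have h2 : LinearMap.funLeft ℂ (Fin 2 → ℂ) (latticeEquiv F V hV) (D.dist (charInv χ) Φf) =
          LinearMap.funLeft ℂ (Fin 2 → ℂ) (latticeEquiv F V hV) 0 := by
        rw [map_zero]; exact h1
      exact funLeft_latticeEquiv_injective F V hV h2
    · intro h
      refine LinearMap.ext fun Φf => ?_
      show LinearMap.funLeft ℂ (Fin 2 → ℂ) (latticeEquiv F V hV) (D.dist (charInv χ) Φf) = 0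
      rw [h Φf, map_zero]

end Generic

/-! ## §3 At the degenerate seesaw context `cDiag a` (★ `Theorems/H413ThetaDistAtLine`) -/

section AtLine

open Summit.HodgeConjecture.HodgeConjecture.Cruxes.H413.ThetaDistAtLine

variable (Φ : CMType (F : Type)) (σ : (F : Type) →+* ℂ) (a : (F : Type)) (ha : IsCMField.complexConj (F : Type) a = a) (ha0 : a ≠ 0)
variable (η : CMAdelic (F : Type) (frameD V) × CMAdelic (F : Type) (dW (cDiag Φ σ a ha ha0).D) →* ℂˣ)
  (hη : ∀ γU ∈ CMRat (F : Type) (frameD V), ∀ γ ∈ CMRat (F : Type) (dW (cDiag Φ σ a ha ha0).D), η (γU, γ) = 1)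
  (hηc : Continuous fun p => ((η p : ℂˣ) : ℂ))
  (ν : CMAdelic (F : Type) (frameD V) →* ℂˣ)
  (hν : ∀ γU ∈ CMRat (F : Type) (frameD V), ν γU = 1)
  (hνc : Continuous fun v => ((ν v : ℂˣ) : ℂ))
  (A : ∀ k : Fin 4, ArchLineInput V (lineRepT V (cDiag Φ σ a ha ha0).D (compat_plane V Φ σ a ha ha0) (compat_line₀ V Φ σ a ha ha0)
    (compat_line₁ V Φ σ a ha ha0) (compat_line₂ V Φ σ a ha ha0) (compat_line₃ V Φ σ a ha ha0) η ν k))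
  (D : (sideAt V Φ σ a ha ha0 η hη hηc ν hν hνc A).ThetaDistDatum hV 0)
  (hLF : ((sideAt V Φ σ a ha ha0 η hη hηc ν hν hνc A).P 0).IsLFAction)
  (hd : ∀ (T : 𝓢((Fin 3 → mixedSpace (↥(maximalRealSubfield F))), ℂ) →L[ℂ] ℂ) (ℓ : Module.Dual ℂ (Fin 2 → ℂ)),
    DifferentiableAt ℝ (fun b => T (D.ωA (BallForms.expP b) (D.Φarch ℓ))) 0)
  (hCR : ∀ (T : 𝓢((Fin 3 → mixedSpace (↥(maximalRealSubfield F))), ℂ) →L[ℂ] ℂ) (ℓ : Module.Dual ℂ (Fin 2 → ℂ)) (v : Fin 2 → ℂ),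
    fderiv ℝ (fun b => T (D.ωA (BallForms.expP b) (D.Φarch ℓ))) 0 (Complex.I • v) =
      Complex.I • fderiv ℝ (fun b => T (D.ωA (BallForms.expP b) (D.Φarch ℓ))) 0 v)
  (χ : PontryaginDual (↥(Literature.NumberTheory.Automorphic.relNormOneIdeles (↥(maximalRealSubfield F)) F) ⧸
      Literature.NumberTheory.Automorphic.relNormOneRat (↥(maximalRealSubfield F)) F))

include hLF hd hCR in
/-- **the descent at the line `a`**: every slot-`0` datum over `sideAt …` yields a `rightRep`-equivariant `θ` on the `χ`-coinvariants of its finite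
Weil representation with values in `holCotForms (archFactorOf F V)` — the two `rfl`s and `sat(K) ≤ archFinOf V` discharged.
[cite: Liu2021, proof of Prop. 4.13, l. 2145; App. D §D.1 Step 3 (l. 5219–5221)] [cite: Weil1964, Chap. III n° 41] -/
theorem exists_coinvLift_dist_sideAt :
    ∃ θ : Literature.RepresentationTheory.TwistedCoinv.Coinv (D.ωf.comp (MonoidHom.inr _ _)) (D.chiFin χ) →ₗ[ℂ]
        ((adelicDatum F V).Adelic → (Fin 2 → ℂ)),
      (∀ Φf : FinSB (↥(maximalRealSubfield F)) (Fin 3),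
          θ (Literature.RepresentationTheory.TwistedCoinv.mk (D.ωf.comp (MonoidHom.inr _ _)) (D.chiFin χ) Φf) =
            LinearMap.funLeft ℂ (Fin 2 → ℂ) (latticeEquiv F V hV) (D.dist (charInv χ) Φf)) ∧
        (∀ (g : ↥(HodgeCM.HermSpace3.adelicFin V))
            (x : Literature.RepresentationTheory.TwistedCoinv.Coinv (D.ωf.comp (MonoidHom.inr _ _)) (D.chiFin χ)),
            θ (Literature.RepresentationTheory.TwistedCoinv.rep (D.chiFin χ) (D.ωf.comp (MonoidHom.inl _ _))
                (commute_ωf_inl_inr F V hV D) g x) =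
              rightRep F V g (θ x)) ∧
          (∀ x, θ x ∈ holCotForms (archFactorOf F V)) ∧
            (θ = 0 ↔ ∀ Φf : FinSB (↥(maximalRealSubfield F)) (Fin 3), D.dist (charInv χ) Φf = 0) :=
  exists_coinvLift_dist F V hV D (sideAt_ιinf V Φ σ a ha ha0 η hη hηc ν hν hνc A) (sideAt_P_ΓU V Φ σ a ha ha0 η hη hηc ν hν hνc A 0)
    (satG_le_sideAt_Gfin F V hV Φ σ a ha ha0 η hη hηc ν hν hνc A) hLF hd hCR χ

end AtLine

end Summit.HodgeConjecture.HodgeConjecture.Cruxes.H413.ThetaJunction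

end
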